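import Summits.KontsevichZagierPeriods.KontsevichZagierPeriods.Theorems.PlanarAreas.Negative.Core
import Literature.NumberTheory.Transcendental.KZUnfolding
import Literature.NumberTheory.Transcendental.SemialgebraicVolume
import Literature.ModelTheory.ExponentialFields.SemialgebraicInterior
import Literature.NumberTheory.Transcendental.KZSemiCanonicalReductionProofs
import Summits.KontsevichZagierPeriods.KontsevichZagierPeriods.Theses.FermatIsogeny

/-!
# `PlanarAreas` (stmt-KontsevichZagierPeriods-4990): negative side — III. normalisations (positive lemmas)

§4 of the negative-side analysis: integrand-`1` representations are exactly finite-area regions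
(`volume_lt_top_of_integrand_one`, `value_eq_toReal_volume`); null regions are relations
(`of_mem_relations_of_volume_eq_zero`), so the AREA-`0` SLICE of the crux is a theorem
(`planarAreas_of_value_eq_zero`); off-domain values of the integrand are irrelevant
(tree: `MzvKernelInKZ.Negative.of_sub_of_mem_relations_of_eqOn`); WLOG both domains are OPEN (`equivalent_interiorRep`,
`planarAreas_iff_open`: the frontier of a semialgebraic set is null).

§5: the crux decides the NON-NEGATIVE DIMENSION-1 SECTOR of Conjecture 1
(`equivalent_dim_one_of_planarAreas`, via `KZ.exists_underGraph`), so any non-equivalent equal-value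
pair of non-negative 1-dimensional representations kills it (`not_planarAreas_of_dim_one`); the
sharpest candidate on record made formal: `isogenyLinearNinth_of_planarAreas` (crux + the Beta
identity `B(5/9,7/9) = (8/3)·3^{1/6}·sin(π/9)·B(5/9,8/9)` ⟹ route FermatIsogeny's
`IsogenyLinearNinth`, stmt-3896).

REPAIR 2026-08-19 (cell pub-kz1p, seat b2b-kz1p-1; ONE identifier removed from an `open … (…)` list, NO statement,
proof or declaration changed): the explicit open list below named `PlanarTransport`, dropped from
`Theses/SymplecticScissors.lean` by the items-cap lint autofix of 2026-08-16T14:16:23Z and unused in this file; with it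
the module did not elaborate at HEAD (same repair as `Core.lean`). -/

noncomputable section

open Set MeasureTheory MvPolynomial Filter Topology
open Literature.NumberTheory.Transcendental Literature.ModelTheory.ExponentialFields

namespace Summit.KontsevichZagierPeriods.PlanarAreas.Negative

open Summit.KontsevichZagierPeriods.KontsevichZagierPeriods.Theses.SymplecticScissors
  (PlanarAreas VolumeForm PlanarK0Injective GroupToAreas)

/-! ## §4 Normalisations (positive lemmas for the provers) -/

/-- An integrand-`1` representation lives on a region of finite area. -/
theorem volume_lt_top_of_integrand_one {n : ℕ} (r : KZ.IntegralRep n)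
    (hr : ∀ p ∈ r.domain, r.integrand p = 1) : volume r.domain < ⊤ := by
  have h1 : IntegrableOn (fun _ => (1:ℝ)) r.domain :=
    r.integrableOn.congr_fun (fun x hx => hr x hx) (KZ.IntegralRep.measurableSet_domain_holds r)
  have := (integrableOn_const_iff (C := (1:ℝ))).mp h1
  simpa using this

/-- Its value is the area. -/
theorem value_eq_toReal_volume {n : ℕ} (r : KZ.IntegralRep n)
    (hr : ∀ p ∈ r.domain, r.integrand p = 1) : r.value = (volume r.domain).toReal := by
  rw [KZ.IntegralRep.value, setIntegral_congr_fun (KZ.IntegralRep.measurableSet_domain_holds r)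
    (fun x hx => hr x hx), setIntegral_const, smul_eq_mul, mul_one, measureReal_def]

/-- Null regions are relations (`[N] − [N] − [N] ∈ domainAddRel` with `N = N ∪ N`). -/
theorem of_mem_relations_of_volume_eq_zero {n : ℕ} (r : KZ.IntegralRep n)
    (h : volume r.domain = 0) : KZ.of r ∈ KZ.relations :=
  KZ.levelRel_le_relations (KZ.of_mem_levelRel_of_volume_eq_zero r h)

/-- **The area-`0` slice of the crux is a theorem**: two integrand-`1` planar representations of
area `0` are equivalent (both are relations). -/
theorem planarAreas_of_value_eq_zero (r r' : KZ.IntegralRep 2)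
    (hr : ∀ p ∈ r.domain, r.integrand p = 1) (hr' : ∀ p ∈ r'.domain, r'.integrand p = 1)
    (h0 : r.value = 0) (hv : r.value = r'.value) : KZ.Equivalent r r' := by
  have hfin := volume_lt_top_of_integrand_one r hr
  have hfin' := volume_lt_top_of_integrand_one r' hr'
  have hz : volume r.domain = 0 := by
    rw [value_eq_toReal_volume r hr, ENNReal.toReal_eq_zero_iff] at h0
    exact h0.resolve_right hfin.ne
  have hz' : volume r'.domain = 0 := by
    rw [hv, value_eq_toReal_volume r' hr', ENNReal.toReal_eq_zero_iff] at h0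
    exact h0.resolve_right hfin'.ne
  exact KZ.relations.sub_mem (of_mem_relations_of_volume_eq_zero r hz)
    (of_mem_relations_of_volume_eq_zero r' hz')

/- Off-domain freedom (`of_sub_of_mem_relations_of_eqOn`: two representations with the same domain
whose integrands agree ON the domain differ by a relation) and `of_mem_relations_of_eqOn_zero` are
already in the tree as `Summit.KontsevichZagierPeriods.MzvKernelInKZ.Negative.of_sub_of_mem_relations_of_eqOn`
/ `…of_mem_relations_of_eqOn_zero` (Theorems/MzvKernelInKZ/Negative/Core.lean); not re-declared here. -/

/-- **WLOG the domain is open**: an integrand-`1` planar representation is equivalent to the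
integrand-`1` representation on the INTERIOR of its domain (the difference `σ ∖ interior σ` lies in
the frontier, which is null for semialgebraic `σ`, and null regions are relations). -/
theorem equivalent_interiorRep (r : KZ.IntegralRep 2) (hr : ∀ p ∈ r.domain, r.integrand p = 1) :
    ∃ r₀ : KZ.IntegralRep 2, r₀.domain = interior r.domain ∧ IsOpen r₀.domain ∧
      (∀ p ∈ r₀.domain, r₀.integrand p = 1) ∧ r₀.value = r.value ∧ KZ.Equivalent r r₀ := by
  have hσ := r.isSemialgebraic_domain
  have hint : IsSemialgebraic ℚ (interior r.domain) := isSemialgebraic_interior hσ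
  have hdiff : IsSemialgebraic ℚ (r.domain \ interior r.domain) := hσ.diff hint
  have hfin := volume_lt_top_of_integrand_one r hr
  have hnull : volume (r.domain \ interior r.domain) = 0 := by
    refine measure_mono_null (fun x hx => ?_) (volume_frontier_eq_zero_of_isSemialgebraic hσ)
    exact ⟨subset_closure hx.1, hx.2⟩
  let r₀ : KZ.IntegralRep 2 := constOneRep (interior r.domain) hint
    (lt_top_iff_ne_top.mp ((measure_mono interior_subset).trans_lt hfin))
  let r₁ : KZ.IntegralRep 2 := constOneRep (r.domain \ interior r.domain) hdiff
    (by rw [hnull]; exact ENNReal.zero_ne_top)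
  have h1a : KZ.of r - KZ.of r₀ - KZ.of r₁ ∈ KZ.relations := by
    refine KZ.domainAddRel_subset_relations ⟨2, r, r₀, r₁, ?_, ?_, ?_, ?_, rfl⟩
    · simp [r₀, r₁, union_sdiff_cancel interior_subset]
    · simp [r₀, r₁]
    · intro x hx; exact hr x (interior_subset hx)
    · intro x hx; exact hr x hx.1
  have h1 : KZ.of r₁ ∈ KZ.relations := of_mem_relations_of_volume_eq_zero r₁ hnull
  refine ⟨r₀, rfl, isOpen_interior, fun _ _ => rfl, ?_, ?_⟩
  · rw [value_constOneRep, value_eq_toReal_volume r hr]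
    congr 1
    exact measure_eq_measure_of_null_sdiff interior_subset hnull
  · have : KZ.of r - KZ.of r₀ = (KZ.of r - KZ.of r₀ - KZ.of r₁) + KZ.of r₁ := by abel
    show KZ.of r - KZ.of r₀ ∈ KZ.relations
    rw [this]
    exact KZ.relations.add_mem h1a h1

/-- The crux restricted to OPEN domains (and literal integrand `1`). -/
def PlanarAreasOpen : Prop :=
  ∀ (r r' : KZ.IntegralRep 2), IsOpen r.domain → IsOpen r'.domain →
    (∀ p ∈ r.domain, r.integrand p = 1) → (∀ p ∈ r'.domain, r'.integrand p = 1) →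
    r.value = r'.value → KZ.Equivalent r r'

/-- **Reduction to open regions**: the crux is equivalent to its restriction to open
finite-area `ℚ`-semialgebraic planar sets. -/
theorem planarAreas_iff_open : PlanarAreas ↔ PlanarAreasOpen := by
  constructor
  · intro h r r' _ _ hr hr' hv
    exact h r r' hr hr' hv
  · intro h r r' hr hr' hv
    obtain ⟨r₀, -, ho, hr₀, hv₀, he⟩ := equivalent_interiorRep r hr
    obtain ⟨r₀', -, ho', hr₀', hv₀', he'⟩ := equivalent_interiorRep r' hr'
    have := h r₀ r₀' ho ho' hr₀ hr₀' (by rw [hv₀, hv₀', hv])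
    exact (he.trans this).trans he'.symm

/-! ## §5 The dimension-1 sector and the sharpest candidate pair

`PlanarAreas` implies Conjecture 1 for any two ONE-dimensional representations with non-negative
integrands and equal values: lift both under their graphs by one Newton–Leibniz move each
(`KZ.exists_underGraph`, tree) and compare the two planar regions.  So every equal-value pair of
non-negative 1-dimensional representations is a TARGET FOR BOTH SIDES (a chain proves an instance,
a separating invariant refutes the crux and the summit); the sharpest on record is route
FermatIsogeny's `IsogenyLinearNinth` (stmt-3896): `B(5/9,7/9) = (8/3)·3^{1/6}·sin(π/9)·B(5/9,8/9)`,
a CM relation on the Fermat curve `F₉` induced by a correspondence, not by automorphisms. -/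

/-- **`PlanarAreas` decides the non-negative dimension-1 sector**: two 1-dimensional representations
with non-negative integrands and equal values are equivalent (both are one Newton–Leibniz move away
from the integrand-`1` regions under their graphs). -/
theorem equivalent_dim_one_of_planarAreas (h : PlanarAreas) {r r' : KZ.IntegralRep 1}
    (h0 : ∀ x ∈ r.domain, 0 ≤ r.integrand x) (h0' : ∀ x ∈ r'.domain, 0 ≤ r'.integrand x)
    (hv : r.value = r'.value) : KZ.Equivalent r r' := by
  obtain ⟨G, -, hGi, hG⟩ := KZ.exists_underGraph r h0
  obtain ⟨G', -, hGi', hG'⟩ := KZ.exists_underGraph r' h0'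
  have hGr : KZ.Equivalent G r := KZ.newtonLeibnizRel_subset_relations hG
  have hGr' : KZ.Equivalent G' r' := KZ.newtonLeibnizRel_subset_relations hG'
  have hvG : G.value = G'.value := by
    rw [KZ.Equivalent.value_eq_holds hGr, KZ.Equivalent.value_eq_holds hGr', hv]
  have hGG' : KZ.Equivalent G G' :=
    h G G' (fun p _ => by rw [hGi]) (fun p _ => by rw [hGi']) hvG
  exact (hGr.symm.trans hGG').trans hGr'

/-- Hence a NON-equivalent equal-value pair of non-negative 1-dimensional representations refutes
the crux (and the summit). -/
theorem not_planarAreas_of_dim_one {r r' : KZ.IntegralRep 1}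
    (h0 : ∀ x ∈ r.domain, 0 ≤ r.integrand x) (h0' : ∀ x ∈ r'.domain, 0 ≤ r'.integrand x)
    (hv : r.value = r'.value) (hne : ¬ KZ.Equivalent r r') : ¬ PlanarAreas :=
  fun h => hne (equivalent_dim_one_of_planarAreas h h0 h0' hv)

/-- **The sharpest candidate pair, formally**: `PlanarAreas` together with the Beta identity
`B(5/9,7/9) = (8/3)·3^{1/6}·sin(π/9)·B(5/9,8/9)` (stated as equality of the values of the two
representations of stmt-3896) implies route FermatIsogeny's crux `IsogenyLinearNinth`; read
contrapositively, an invariant separating these two Beta integrals kills `PlanarAreas`. -/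
theorem isogenyLinearNinth_of_planarAreas (h : PlanarAreas)
    (hB : ∀ (r r' : KZ.IntegralRep 1), r.domain = {x | x 0 ∈ Set.Ioo (0:ℝ) 1} →
      Set.EqOn r.integrand (fun x => (x 0) ^ (-(4:ℝ)/9) * (1 - x 0) ^ (-(2:ℝ)/9)) r.domain →
      r'.domain = {x | x 0 ∈ Set.Ioo (0:ℝ) 1} →
      Set.EqOn r'.integrand (fun x => (8/3 : ℝ) * (3:ℝ) ^ ((1:ℝ)/6) * Real.sin (Real.pi / 9) *
        (x 0) ^ (-(1:ℝ)/9) * (1 - x 0) ^ (-(4:ℝ)/9)) r'.domain →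
      r.value = r'.value) :
    Summit.KontsevichZagierPeriods.KontsevichZagierPeriods.Theses.FermatIsogeny.IsogenyLinearNinth := by
  intro r r' hr hri hr' hri'
  have hsin : 0 < Real.sin (Real.pi / 9) :=
    Real.sin_pos_of_pos_of_lt_pi (by positivity) (by linarith [Real.pi_pos])
  refine equivalent_dim_one_of_planarAreas h (fun x hx => ?_) (fun x hx => ?_)
    (hB r r' hr hri hr' hri')
  · have hx' : x 0 ∈ Set.Ioo (0:ℝ) 1 := by rw [hr] at hx; exact hx
    rw [hri hx]
    exact mul_nonneg (Real.rpow_nonneg hx'.1.le _) (Real.rpow_nonneg (by linarith [hx'.2]) _)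
  · have hx' : x 0 ∈ Set.Ioo (0:ℝ) 1 := by rw [hr'] at hx; exact hx
    rw [hri' hx]
    refine mul_nonneg (mul_nonneg ?_ (Real.rpow_nonneg hx'.1.le _))
      (Real.rpow_nonneg (by linarith [hx'.2]) _)
    exact mul_nonneg (mul_nonneg (by norm_num) (Real.rpow_nonneg (by norm_num) _)) hsin.le

end Summit.KontsevichZagierPeriods.PlanarAreas.Negative

end
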